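import Mathlib
import Summits.NavierStokesRegularity.NavierStokesRegularity.Theorems.FilamentSkeletonRssSelectionBoxRJRungGradKernelLipschitz
import Summits.NavierStokesRegularity.NavierStokesRegularity.Theorems.FilamentSkeletonRssSkeletonEquilibriumBiotSavartDirectionalDeriv

/-!
# Route `FilamentSkeletonRss` · crux `SelectionBoxRJ` (stmt-NavierStokesRegularity-21220) — rung tools (R2, brick 2b):
# Lipschitz dependence of the GRADIENT of the regularised Biot–Savart field on the filament, seen from distance `D`

Lane `ns-filament-19175-p1` (g7); helper file `--supports stmt-NavierStokesRegularity-21220`, route-independent.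

The gradient analogue of g6's `biotSavart_curveLipschitz` (`…RungPartnerLipschitz`), with an AFFINE position hypothesis so
that a pure translation of the filament is covered too: two `C¹` filaments `X, X′` (`‖X′‖, ‖X'′‖ ≤ 1`, linear growth), whose
tangents differ by `≤ θ` and whose positions differ by `≤ θ|u − u₀| + B`; a point `y` at distance `≥ D` from both with linear
escape `c|u − u₀| − A`.  Then (`biotSavart_grad_curveLipschitz`) the Fréchet derivatives of the two fields at `y` differ in
operator norm by at most `2π(D + A)(4θ + 24θ(D + A)/(cD) + 24B/D)/(cD³)`, uniformly in the core `e ≠ 0` — `O(θ/D²)` and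
`O(B/D³)` in the rung's geometry.  (Pointwise bound `grad_integrand_lipschitz`; Cauchy majorant for `1/m³`; the derivative is
the integral of the gradient integrand by `biotSavart_fderiv_apply_eq`.)

HONEST FRAMING.  Kernel bookkeeping for the rung ladder of a HYPOTHETICAL filament box (the `C¹` input `ε₁` of the R2 zero
package); nothing here is a claim about Navier–Stokes regularity or blow-up.
-/

set_option linter.dupNamespace false -- `Theorems.…Theorems`-style path/namespace repetition is the tree convention

noncomputable section

namespace Summit.NavierStokesRegularity.NavierStokesRegularity.Theorems

open Set Function Filter MeasureTheory Real
open Literature.Analysis.FluidPDE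
open Summit.NavierStokesRegularity.NavierStokesRegularity.Theorems.SkeletonEquilibrium.Sketch
open scoped InnerProductSpace Topology

namespace SelectionBoxRJRung

/-- **Gradient curve-Lipschitz estimate (directional form).**  Under the hypotheses described in the module docstring,
for every direction `v`:
`‖(fderiv F[X] y − fderiv F[X′] y) v‖ ≤ 2π‖v‖(D + A)(4θ + 24θ(D + A)/(cD) + 24B/D)/(cD³)`. [folklore] -/
theorem biotSavart_grad_curveLipschitz_apply {e c₀ C C' c D A B u₀ θ : ℝ} {X X' : ℝ → EuclideanSpace ℝ (Fin 3)}
    {y : EuclideanSpace ℝ (Fin 3)} (he : e ≠ 0) (hc₀ : 0 < c₀)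
    (hX : ContDiff ℝ 1 X) (hdX : ∀ u, ‖deriv X u‖ ≤ 1) (hgrow : ∀ u, c₀ * |u| - C ≤ ‖X u‖)
    (hX' : ContDiff ℝ 1 X') (hdX' : ∀ u, ‖deriv X' u‖ ≤ 1) (hgrow' : ∀ u, c₀ * |u| - C' ≤ ‖X' u‖)
    (hθ : 0 ≤ θ) (hB : 0 ≤ B) (htan : ∀ u, ‖deriv X u - deriv X' u‖ ≤ θ)
    (hpos : ∀ u, ‖X u - X' u‖ ≤ θ * |u - u₀| + B)
    (hc : 0 < c) (hD : 0 < D) (hA : 0 ≤ A)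
    (hfar : ∀ u, D ≤ ‖y - X u‖) (hfar' : ∀ u, D ≤ ‖y - X' u‖)
    (hesc : ∀ u, c * |u - u₀| - A ≤ ‖y - X u‖) (hesc' : ∀ u, c * |u - u₀| - A ≤ ‖y - X' u‖)
    (v : EuclideanSpace ℝ (Fin 3)) :
    ‖fderiv ℝ (fun y : EuclideanSpace ℝ (Fin 3) => ∫ u : ℝ,
          ((‖y - X u‖ ^ 2 + e ^ 2) ^ (3 / 2 : ℝ))⁻¹ • cross (deriv X u) (y - X u)) y v -
        fderiv ℝ (fun y : EuclideanSpace ℝ (Fin 3) => ∫ u : ℝ,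
          ((‖y - X' u‖ ^ 2 + e ^ 2) ^ (3 / 2 : ℝ))⁻¹ • cross (deriv X' u) (y - X' u)) y v‖ ≤
      2 * Real.pi * ‖v‖ * (D + A) * (4 * θ + 24 * θ * (D + A) / (c * D) + 24 * B / D) / (c * D ^ 3) := by
  rw [biotSavart_fderiv_apply_eq he hc₀ hX hdX hgrow y v, biotSavart_fderiv_apply_eq he hc₀ hX' hdX' hgrow' y v]
  obtain ⟨hI, -⟩ := stub_biotSavartDirectionalDeriv e c₀ C X he hc₀ hX hdX hgrow y v
  obtain ⟨hI', -⟩ := stub_biotSavartDirectionalDeriv e c₀ C' X' he hc₀ hX' hdX' hgrow' y v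
  rw [← integral_sub hI hI']
  have hDA : 0 < D + A := by linarith
  have hv : 0 ≤ ‖v‖ := norm_nonneg _
  set k : ℝ := c / (D + A) with hk
  have hkpos : 0 < k := div_pos hc hDA
  -- constant in front of the Cauchy majorant
  set Lg : ℝ := 4 * θ + 24 * θ * (D + A) / (c * D) + 24 * B / D with hLg
  have hLg0 : 0 ≤ Lg := by rw [hLg]; positivity
  set L : ℝ := ‖v‖ * Lg * (2 / D ^ 3) with hL
  have hL0 : 0 ≤ L := by rw [hL]; positivity
  set g : ℝ → ℝ := fun u => L * (1 + (k * (u - u₀)) ^ 2)⁻¹ with hg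
  have hg_int : Integrable g := by
    have h0 : Integrable (fun u : ℝ => (1 + (k * u) ^ 2)⁻¹) :=
      integrable_inv_one_add_sq.comp_mul_left' hkpos.ne'
    exact (h0.comp_sub_right u₀).const_mul _
  have hg_val : ∫ u, g u = L * ((D + A) / c * Real.pi) := by
    rw [hg, integral_const_mul]
    congr 1
    have h1 : ∫ u : ℝ, (1 + (k * (u - u₀)) ^ 2)⁻¹ = ∫ u : ℝ, (1 + (k * u) ^ 2)⁻¹ :=
      integral_sub_right_eq_self (fun u : ℝ => (1 + (k * u) ^ 2)⁻¹) u₀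
    rw [h1, Measure.integral_comp_mul_left (fun y : ℝ => (1 + y ^ 2)⁻¹), integral_univ_inv_one_add_sq,
      smul_eq_mul, hk, inv_div, abs_of_pos (div_pos hDA hc)]
  have hbound : ∀ u : ℝ,
      ‖((-3 * ⟪y - X u, v⟫_ℝ * ((‖y - X u‖ ^ 2 + e ^ 2) ^ (5 / 2 : ℝ))⁻¹) • cross (deriv X u) (y - X u)
          + ((‖y - X u‖ ^ 2 + e ^ 2) ^ (3 / 2 : ℝ))⁻¹ • cross (deriv X u) v) -
        ((-3 * ⟪y - X' u, v⟫_ℝ * ((‖y - X' u‖ ^ 2 + e ^ 2) ^ (5 / 2 : ℝ))⁻¹) • cross (deriv X' u) (y - X' u)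
          + ((‖y - X' u‖ ^ 2 + e ^ 2) ^ (3 / 2 : ℝ))⁻¹ • cross (deriv X' u) v)‖ ≤ g u := by
    intro u
    set m : ℝ := max D (c * |u - u₀| - A) with hm
    have hm0 : 0 < m := lt_max_of_lt_left hD
    have hmD : D ≤ m := le_max_left _ _
    have hme : c * |u - u₀| - A ≤ m := le_max_right _ _
    have hmz : m ≤ ‖y - X u‖ := max_le (hfar u) (hesc u)
    have hmz' : m ≤ ‖y - X' u‖ := max_le (hfar' u) (hesc' u)
    have hzz : ‖(y - X u) - (y - X' u)‖ ≤ θ * |u - u₀| + B := by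
      rw [show (y - X u) - (y - X' u) = -(X u - X' u) by abel, norm_neg]; exact hpos u
    -- `4θ/m³ + 24(θ|u−u₀| + B)/m⁴ ≤ Lg/m³`
    have hu : |u - u₀| ≤ (m + A) / c := by rw [le_div_iff₀ hc]; linarith only [hme]
    have hmA : (m + A) / (c * m) ≤ (D + A) / (c * D) := by
      rw [div_le_div_iff₀ (by positivity) (by positivity)]
      nlinarith only [mul_nonneg hA (sub_nonneg.2 hmD), hc, hmD, hA, hm0]
    have h2 : 4 * θ / m ^ 3 + 24 * (θ * |u - u₀| + B) / m ^ 4 ≤ Lg / m ^ 3 := by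
      have s1 : 24 * (θ * |u - u₀|) / m ^ 4 ≤ 24 * θ * ((D + A) / (c * D)) / m ^ 3 := by
        calc 24 * (θ * |u - u₀|) / m ^ 4 ≤ 24 * (θ * ((m + A) / c)) / m ^ 4 := by gcongr
          _ = 24 * θ * ((m + A) / (c * m)) / m ^ 3 := by field_simp
          _ ≤ 24 * θ * ((D + A) / (c * D)) / m ^ 3 := by gcongr
      have s2 : 24 * B / m ^ 4 ≤ 24 * B / D / m ^ 3 := by
        rw [div_div, div_le_div_iff₀ (by positivity) (by positivity)]
        have hDm : D * m ^ 3 ≤ m ^ 4 := by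
          calc D * m ^ 3 ≤ m * m ^ 3 := mul_le_mul_of_nonneg_right hmD (pow_pos hm0 3).le
            _ = m ^ 4 := by ring
        have := mul_le_mul_of_nonneg_left hDm (by positivity : (0:ℝ) ≤ 24 * B)
        linarith only [this]
      have hsplit : 24 * (θ * |u - u₀| + B) / m ^ 4 = 24 * (θ * |u - u₀|) / m ^ 4 + 24 * B / m ^ 4 := by ring
      rw [hsplit, hLg]
      have e3 : (4 * θ + 24 * θ * (D + A) / (c * D) + 24 * B / D) / m ^ 3 =
          4 * θ / m ^ 3 + 24 * θ * ((D + A) / (c * D)) / m ^ 3 + 24 * B / D / m ^ 3 := by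
        field_simp
      rw [e3]
      linarith only [s1, s2]
    -- Cauchy majorant for `1/m³`
    have hcore := cauchy_majorant_core (u := u) (u₀ := u₀) hD hA hc hmD hme
    have h3 : ‖v‖ * (Lg / m ^ 3) ≤ g u := by
      show ‖v‖ * (Lg / m ^ 3) ≤ L * (1 + (k * (u - u₀)) ^ 2)⁻¹
      have hkq : k * (u - u₀) = c * (u - u₀) / (D + A) := by rw [hk]; ring
      rw [hkq, hL]
      have hq : 0 < 1 + (c * (u - u₀) / (D + A)) ^ 2 := by positivity
      have hm3 : D ^ 3 * (1 + (c * (u - u₀) / (D + A)) ^ 2) ≤ 2 * m ^ 3 := by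
        have h := mul_le_mul hmD hcore (by positivity) hm0.le
        calc D ^ 3 * (1 + (c * (u - u₀) / (D + A)) ^ 2) = D * (D ^ 2 * (1 + (c * (u - u₀) / (D + A)) ^ 2)) := by ring
          _ ≤ m * (2 * m ^ 2) := h
          _ = 2 * m ^ 3 := by ring
      have hinv : (m ^ 3)⁻¹ ≤ 2 / D ^ 3 * (1 + (c * (u - u₀) / (D + A)) ^ 2)⁻¹ := by
        rw [show 2 / D ^ 3 * (1 + (c * (u - u₀) / (D + A)) ^ 2)⁻¹ =
            2 / (D ^ 3 * (1 + (c * (u - u₀) / (D + A)) ^ 2)) by field_simp, inv_eq_one_div,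
          div_le_div_iff₀ (pow_pos hm0 3) (by positivity)]
        linarith only [hm3]
      calc ‖v‖ * (Lg / m ^ 3) = ‖v‖ * Lg * (m ^ 3)⁻¹ := by rw [div_eq_mul_inv]; ring
        _ ≤ ‖v‖ * Lg * (2 / D ^ 3 * (1 + (c * (u - u₀) / (D + A)) ^ 2)⁻¹) :=
            mul_le_mul_of_nonneg_left hinv (by positivity)
        _ = ‖v‖ * Lg * (2 / D ^ 3) * (1 + (c * (u - u₀) / (D + A)) ^ 2)⁻¹ := by ring
    have h1 := grad_integrand_lipschitz e (v := v) (hdX u) (hdX' u) (htan u) hzz hm0 hmz hmz'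
    exact h1.trans ((mul_le_mul_of_nonneg_left h2 hv).trans h3)
  have hfin : L * ((D + A) / c * Real.pi) =
      2 * Real.pi * ‖v‖ * (D + A) * (4 * θ + 24 * θ * (D + A) / (c * D) + 24 * B / D) / (c * D ^ 3) := by
    rw [hL, hLg]; field_simp
  calc _ ≤ ∫ u, g u := norm_integral_le_of_norm_le hg_int (Eventually.of_forall hbound)
    _ = L * ((D + A) / c * Real.pi) := hg_val
    _ = _ := hfin

/-- **Gradient curve-Lipschitz estimate (operator-norm form).** [folklore] -/
theorem biotSavart_grad_curveLipschitz {e c₀ C C' c D A B u₀ θ : ℝ} {X X' : ℝ → EuclideanSpace ℝ (Fin 3)}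
    {y : EuclideanSpace ℝ (Fin 3)} (he : e ≠ 0) (hc₀ : 0 < c₀)
    (hX : ContDiff ℝ 1 X) (hdX : ∀ u, ‖deriv X u‖ ≤ 1) (hgrow : ∀ u, c₀ * |u| - C ≤ ‖X u‖)
    (hX' : ContDiff ℝ 1 X') (hdX' : ∀ u, ‖deriv X' u‖ ≤ 1) (hgrow' : ∀ u, c₀ * |u| - C' ≤ ‖X' u‖)
    (hθ : 0 ≤ θ) (hB : 0 ≤ B) (htan : ∀ u, ‖deriv X u - deriv X' u‖ ≤ θ)
    (hpos : ∀ u, ‖X u - X' u‖ ≤ θ * |u - u₀| + B)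
    (hc : 0 < c) (hD : 0 < D) (hA : 0 ≤ A)
    (hfar : ∀ u, D ≤ ‖y - X u‖) (hfar' : ∀ u, D ≤ ‖y - X' u‖)
    (hesc : ∀ u, c * |u - u₀| - A ≤ ‖y - X u‖) (hesc' : ∀ u, c * |u - u₀| - A ≤ ‖y - X' u‖) :
    ‖fderiv ℝ (fun y : EuclideanSpace ℝ (Fin 3) => ∫ u : ℝ,
          ((‖y - X u‖ ^ 2 + e ^ 2) ^ (3 / 2 : ℝ))⁻¹ • cross (deriv X u) (y - X u)) y -
        fderiv ℝ (fun y : EuclideanSpace ℝ (Fin 3) => ∫ u : ℝ,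
          ((‖y - X' u‖ ^ 2 + e ^ 2) ^ (3 / 2 : ℝ))⁻¹ • cross (deriv X' u) (y - X' u)) y‖ ≤
      2 * Real.pi * (D + A) * (4 * θ + 24 * θ * (D + A) / (c * D) + 24 * B / D) / (c * D ^ 3) := by
  refine ContinuousLinearMap.opNorm_le_bound _ (by positivity) fun v => ?_
  rw [show (fderiv ℝ (fun y : EuclideanSpace ℝ (Fin 3) => ∫ u : ℝ,
          ((‖y - X u‖ ^ 2 + e ^ 2) ^ (3 / 2 : ℝ))⁻¹ • cross (deriv X u) (y - X u)) y -
        fderiv ℝ (fun y : EuclideanSpace ℝ (Fin 3) => ∫ u : ℝ,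
          ((‖y - X' u‖ ^ 2 + e ^ 2) ^ (3 / 2 : ℝ))⁻¹ • cross (deriv X' u) (y - X' u)) y) v =
      fderiv ℝ (fun y : EuclideanSpace ℝ (Fin 3) => ∫ u : ℝ,
          ((‖y - X u‖ ^ 2 + e ^ 2) ^ (3 / 2 : ℝ))⁻¹ • cross (deriv X u) (y - X u)) y v -
        fderiv ℝ (fun y : EuclideanSpace ℝ (Fin 3) => ∫ u : ℝ,
          ((‖y - X' u‖ ^ 2 + e ^ 2) ^ (3 / 2 : ℝ))⁻¹ • cross (deriv X' u) (y - X' u)) y v from rfl]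
  calc _ ≤ 2 * Real.pi * ‖v‖ * (D + A) * (4 * θ + 24 * θ * (D + A) / (c * D) + 24 * B / D) / (c * D ^ 3) :=
        biotSavart_grad_curveLipschitz_apply he hc₀ hX hdX hgrow hX' hdX' hgrow' hθ hB htan hpos hc hD hA hfar hfar'
          hesc hesc' v
    _ = 2 * Real.pi * (D + A) * (4 * θ + 24 * θ * (D + A) / (c * D) + 24 * B / D) / (c * D ^ 3) * ‖v‖ := by ring

end SelectionBoxRJRung

end Summit.NavierStokesRegularity.NavierStokesRegularity.Theorems
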